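import Literature.RingTheory.KTheory.CyclicEigen
import Literature.RingTheory.KTheory.KZeroRing
import Mathlib.GroupTheory.Perm.Fin
import HarnessLib

/-!
# The Adams operations `ψ², ψ³` on `K₀` of a commutative `ℂ`-algebra (Atiyah's power operations)

For a commutative `ℂ`-algebra `R` (e.g. `R = C(X, ℂ)`, where `K₀(R) = K⁰(X)`) we construct the
Adams operations `ψ^k : K₀(R) → K₀(R)` for `k = 2, 3` **without the splitting principle**,
following M. F. Atiyah, "Power operations in `K`-theory" (1966), §2: the cyclic group `ℤ/k`
permutes the tensor factors of `p^{⊗k}` (`p` an idempotent matrix over `R`), the cyclic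
permutation `T` has the eigen-idempotents `E_j(T)` (`CyclicEigen.lean`), and for `k` prime
**`ψ^k[p] = [E_0(T) p^{⊗k}] - [E_1(T) p^{⊗k}]`** (Atiyah's formula (2.7):
`ψ^p[V] = [V_0] - [V_1]`). Contents, all proved:

* §4 `kc M ∈ K₀(R)`, the class of an idempotent matrix on any finite index type, and its calculus
  (`kc_fromBlocks`, `kc_kronecker`, `kc_one`, `kc_map`, `kc_conj`, `kc_submatrix`), the
  splitting `[Q] = [e Q] + [(1 - e) Q]` along a commuting idempotent (`kc_eq_add_of_comm`) and
  along a partition of unity by orthogonal idempotents (`kc_sum_mul`, `kc_eq_sum_of_partition`);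
* §5–7 the cyclic shift `cyc R ι k` of the `k` slots (`finRotate_pow_self`), the **cyclic parts**
  `part k j M = [E_j(T) M^{⊗k}]` and `psiM k M = part k 0 M - part k 1 M`; well-definedness on
  `K₀` (`part_eq_of_algEquivalent`, Atiyah Prop. 2.2), re-indexing invariance, line elements
  (`IsLine.psiM_eq : ψ^k[L] = [L]^k`, with `kc_tpow : [M^{⊗k}] = [M]^k`), the reflection
  symmetry `[V_j] = [V_{-j}]` (`part_neg`), naturality under `ℂ`-algebra maps (`map_psiM`);
* §8–9 the **phase lemma** `kc_free_mul_eig_eq` (on a free `ℤ/k`-orbit of idempotents all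
  eigen-idempotents of the generator cut out the same class — the matrix form of "induced
  characters vanish off the subgroup" in Atiyah's proof of additivity, Prop. 2.3) and its
  corollary `kc_eig_zero_sub_one_eq_sum_fixed`;
* §10 **additivity** `ψ^k[P ⊕ Q] = ψ^k[P] + ψ^k[Q]` (`psiM_fromBlocks`, via the type projections
  `tyP` of `(P ⊕ Q)^{⊗k}`; the phase functions for `k = 2, 3` are checked by `decide`);
* §11 the class `IsAdamsPrime k` (`k = 2 ∨ k = 3`), `psiClassHom`, and
  **`psi R k : KZero R →+ KZero R`** with `psi_of : ψ^k [p] = psiM k p.mat`, `psi_kc`.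

Multiplicativity, `ψ^k(1) = 1`, `ψ²(x) ≡ x² (mod 2)`, naturality on `K₀` and `ψ²ψ³ = ψ³ψ²` are in
`AdamsOperationsMul.lean`. No named facts are introduced.

## References

* M. F. Atiyah, Power operations in `K`-theory, Quart. J. Math. Oxford (2) 17 (1966) 165–193,
  §2: Prop. 2.2 (operations well defined on `K`), Prop. 2.3 (additivity of `ψ^k` via induced
  representations), Prop. 2.5 and (2.7) (`ψ^p[V] = [V_0] - [V_1]`). [Atiyah1966PowerOperations]
* D. Husemöller, M. Joachim, B. Jurčo, M. Schottenloher, *Basic Bundle Theory and K-Cohomology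
  Invariants* (2008), Ch. 3 §5, Ch. 4 (the idempotent model of `K₀`). [HusemollerEtAl2008]

## Design notes

* `kc M := if h : IsIdempotentElem M then [ofMatrix M h] else 0` avoids threading idempotency
  proofs through statements; every lemma unfolds it with `kc_eq`.
* Only the exponents `2, 3` are packaged (`IsAdamsPrime`), which is what the Adams–Atiyah proof
  of Hopf invariant one uses; the combinatorial inputs (phase functions, the reflection inverting
  the `k`-cycle) are produced by `decide`, all other arguments are uniform in `k`.
* Mathlib/tree searches: `AdamsOperation`, `LambdaRing`, `psi` in `RingTheory`/`KTheory` — absent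
  (2026-08-15); nothing restated.
-/

noncomputable section

namespace Literature.RingTheory.KTheory

open Matrix Finset Kronecker

universe u

variable {R : Type u} [CommRing R]








/-! ### 4. Classes of idempotent matrices in `K₀(R)` -/

section KC

variable {α β γ : Type*} [Fintype α] [Fintype β] [Fintype γ]

open Classical in
/-- The class `[M] ∈ K₀(R)` of a square matrix over `R` indexed by any finite type (`0` if `M` is
not idempotent). [cite: HusemollerEtAl2008, Ch. 4 Def. 4.3] -/
def kc (M : Matrix α α R) : KZero R := if h : IsIdempotentElem M then KZero.of (Idem.ofMatrix M h) else 0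

/-- Adams operations via cyclic power operations (Atiyah 1966 §2). [folklore] -/
theorem kc_eq {M : Matrix α α R} (h : IsIdempotentElem M) : kc M = KZero.of (Idem.ofMatrix M h) := by
  rw [kc, dif_pos h]

/-- Adams operations via cyclic power operations (Atiyah 1966 §2). [folklore] -/
theorem kc_mat (p : Idem R) : kc p.mat = KZero.of p := by
  rw [kc_eq p.isIdempotentElem]
  exact KZero.of_eq_of (Idem.algEquivalent_ofMatrix _ _)

/-- Algebraically equivalent idempotents have the same class. [cite: HusemollerEtAl2008, Ch. 3 Def. 5.4] -/
theorem kc_eq_of_algEquivalent {M : Matrix α α R} {M' : Matrix β β R} (h : AlgEquivalent M M') : kc M = kc M' := by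
  rw [kc_eq h.isIdempotentElem_left, kc_eq h.isIdempotentElem_right]
  exact KZero.of_eq_of ((Idem.algEquivalent_ofMatrix _ _).trans (h.trans (Idem.algEquivalent_ofMatrix _ _).symm))

/-- Adams operations via cyclic power operations (Atiyah 1966 §2). [folklore] -/
theorem kc_zero : kc (0 : Matrix α α R) = 0 := by
  rw [kc_eq_of_algEquivalent (AlgEquivalent.zero_zero (κ := Fin 0)), ← KZero.of_zero (R := R), ← kc_mat]
  rfl

/-- Adams operations via cyclic power operations (Atiyah 1966 §2). [folklore] -/
theorem kc_submatrix {M : Matrix α α R} (hM : IsIdempotentElem M) (e : β ≃ α) : kc (M.submatrix e e) = kc M :=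
  kc_eq_of_algEquivalent (AlgEquivalent.submatrix hM e).symm

/-- Conjugation invariance: `[u M v] = [M]` for `v u = 1`. [cite: HusemollerEtAl2008, Ch. 3 Def. 5.4] -/
theorem kc_conj [DecidableEq α] {M u v : Matrix α α R} (hM : IsIdempotentElem M) (hvu : v * u = 1) : kc (u * M * v) = kc M :=
  (kc_eq_of_algEquivalent (AlgEquivalent.conj hM hvu)).symm

/-- `[P ⊕ Q] = [P] + [Q]`. [cite: HusemollerEtAl2008, Ch. 4 Constr. 1.4] -/
theorem kc_fromBlocks [DecidableEq α] [DecidableEq β] {P : Matrix α α R} {Q : Matrix β β R} (hP : IsIdempotentElem P) (hQ : IsIdempotentElem Q) :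
    kc (Matrix.fromBlocks P 0 0 Q) = kc P + kc Q := by
  rw [kc_eq hP, kc_eq hQ, ← KZero.of_add, ← kc_mat]
  apply kc_eq_of_algEquivalent
  rw [Idem.add_mat]
  refine (AlgEquivalent.fromBlocks (Idem.algEquivalent_ofMatrix P hP).symm (Idem.algEquivalent_ofMatrix Q hQ).symm).trans ?_
  exact AlgEquivalent.reindex (isIdempotentElem_fromBlocks (Idem.ofMatrix P hP).isIdempotentElem (Idem.ofMatrix Q hQ).isIdempotentElem) _

/-- `[P ⊗ Q] = [P] [Q]`. [cite: HusemollerEtAl2008, Ch. 4 Def. 4.1] -/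
theorem kc_kronecker {P : Matrix α α R} {Q : Matrix β β R} (hP : IsIdempotentElem P) (hQ : IsIdempotentElem Q) :
    kc (P ⊗ₖ Q) = kc P * kc Q := by
  rw [kc_eq hP, kc_eq hQ, KZero.of_mul_of, ← kc_mat]
  apply kc_eq_of_algEquivalent
  exact (AlgEquivalent.kronecker (Idem.algEquivalent_ofMatrix P hP).symm (Idem.algEquivalent_ofMatrix Q hQ).symm).trans
    (Idem.mul_equiv_kronecker _ _).symm

/-- `[1_α] = |α|`. [cite: HusemollerEtAl2008, Ch. 4 Rem. 2.5] -/
theorem kc_one [DecidableEq α] : kc (1 : Matrix α α R) = Fintype.card α := by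
  rw [← KZero.of_unit_eq_natCast, ← kc_mat]
  apply kc_eq_of_algEquivalent
  have h : AlgEquivalent (1 : Matrix (Fin (Fintype.card α)) (Fin (Fintype.card α)) R)
      ((1 : Matrix (Fin (Fintype.card α)) (Fin (Fintype.card α)) R).submatrix (Fintype.equivFin α) (Fintype.equivFin α)) :=
    AlgEquivalent.submatrix IsIdempotentElem.one _
  rw [submatrix_one_equiv] at h
  exact h.symm

/-- Functoriality: `K₀(f) [M] = [f(M)]`. [cite: HusemollerEtAl2008, Ch. 4 Rem. 4.4] -/
theorem kc_map [DecidableEq α] {S : Type*} [CommRing S] (f : R →+* S) {M : Matrix α α R} (hM : IsIdempotentElem M) :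
    KZero.map f (kc M) = kc (M.map f) := by
  have hM' : IsIdempotentElem (M.map f) := by
    have h := hM.map (RingHom.mapMatrix f)
    rwa [RingHom.mapMatrix_apply] at h
  rw [kc_eq hM, kc_eq hM', KZero.map_of]
  rfl

/-- **Splitting off a commuting idempotent**: `[Q] = [e Q] + [(1 - e) Q]` for idempotents `e`, `Q`
with `e Q = Q e`. [folklore] -/
theorem kc_eq_add_of_comm [DecidableEq α] {Q e : Matrix α α R} (hQ : IsIdempotentElem Q) (he : IsIdempotentElem e) (hc : e * Q = Q * e) :
    kc Q = kc (e * Q) + kc ((1 - e) * Q) := by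
  have heQ : IsIdempotentElem (e * Q) := by
    change e * Q * (e * Q) = e * Q
    rw [Matrix.mul_assoc, ← Matrix.mul_assoc Q e, ← hc, Matrix.mul_assoc, hQ.eq, ← Matrix.mul_assoc, he.eq]
  have hc' : (1 - e) * Q = Q * (1 - e) := by rw [Matrix.sub_mul, Matrix.mul_sub, Matrix.one_mul, Matrix.mul_one, hc]
  have he' : IsIdempotentElem (1 - e) := he.one_sub
  have heQ' : IsIdempotentElem ((1 - e) * Q) := by
    change (1 - e) * Q * ((1 - e) * Q) = (1 - e) * Q
    rw [Matrix.mul_assoc, ← Matrix.mul_assoc Q (1 - e), ← hc', Matrix.mul_assoc, hQ.eq, ← Matrix.mul_assoc, he'.eq]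
  have h0 : e * Q * ((1 - e) * Q) = 0 := by
    rw [Matrix.mul_assoc, ← Matrix.mul_assoc Q, ← hc', ← Matrix.mul_assoc, ← Matrix.mul_assoc, Matrix.mul_sub, Matrix.mul_one,
      he.eq, sub_self, Matrix.zero_mul, Matrix.zero_mul]
  have h0' : (1 - e) * Q * (e * Q) = 0 := by
    rw [Matrix.mul_assoc, ← Matrix.mul_assoc Q, ← hc, ← Matrix.mul_assoc, ← Matrix.mul_assoc, Matrix.sub_mul, Matrix.one_mul,
      he.eq, sub_self, Matrix.zero_mul, Matrix.zero_mul]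
  rw [← kc_fromBlocks heQ heQ']
  refine kc_eq_of_algEquivalent ((AlgEquivalent.fromBlocks_zero (κ := α) hQ).symm.trans ?_)
  refine AlgEquivalent.of_mul_eq (isIdempotentElem_fromBlocks hQ IsIdempotentElem.zero) (isIdempotentElem_fromBlocks heQ heQ')
    (x := Matrix.fromBlocks (e * Q) ((1 - e) * Q) 0 0) (y := Matrix.fromBlocks (e * Q) 0 ((1 - e) * Q) 0) ?_ ?_
  · rw [Matrix.fromBlocks_multiply]
    simp only [Matrix.mul_zero, Matrix.zero_mul, add_zero, heQ.eq, heQ'.eq]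
    congr 1
    rw [← Matrix.add_mul, add_sub_cancel, Matrix.one_mul]
  · rw [Matrix.fromBlocks_multiply]
    simp only [Matrix.mul_zero, add_zero, heQ.eq, heQ'.eq, h0, h0']

/-- A sum of pairwise orthogonal idempotents is idempotent. [folklore] -/
theorem isIdempotentElem_sum_of_orth {τ : Type*} (s : Finset τ) (G : τ → Matrix α α R) (hGi : ∀ t, IsIdempotentElem (G t))
    (hGo : ∀ t t', t ≠ t' → G t * G t' = 0) : IsIdempotentElem (∑ t ∈ s, G t) := by
  classical
  change (∑ t ∈ s, G t) * (∑ t ∈ s, G t) = ∑ t ∈ s, G t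
  rw [Finset.sum_mul_sum]
  rw [← Finset.sum_product']
  rw [Finset.sum_product]
  refine Finset.sum_congr rfl fun t ht ↦ ?_
  rw [Finset.sum_eq_single t]
  · exact (hGi t).eq
  · intro t' _ h; exact hGo t t' (Ne.symm h)
  · intro h; exact absurd ht h

/-- **Orthogonal decomposition**: `[(∑_t G_t) Q] = ∑_t [G_t Q]` for pairwise orthogonal idempotents
`G_t` commuting with the idempotent `Q`. [folklore] -/
theorem kc_sum_mul [DecidableEq α] {τ : Type*} (s : Finset τ) (G : τ → Matrix α α R) (hGi : ∀ t, IsIdempotentElem (G t))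
    (hGo : ∀ t t', t ≠ t' → G t * G t' = 0) {Q : Matrix α α R} (hQ : IsIdempotentElem Q) (hc : ∀ t, G t * Q = Q * G t) :
    kc ((∑ t ∈ s, G t) * Q) = ∑ t ∈ s, kc (G t * Q) := by
  classical
  induction s using Finset.induction_on with
  | empty => simp [kc_zero]
  | insert t s hts ih =>
    rw [Finset.sum_insert hts, Finset.sum_insert hts, ← ih]
    have hS : IsIdempotentElem (∑ t ∈ s, G t) := isIdempotentElem_sum_of_orth s G hGi hGo
    have hSc : (∑ t ∈ s, G t) * Q = Q * ∑ t ∈ s, G t := by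
      rw [Finset.sum_mul, Finset.mul_sum]; exact Finset.sum_congr rfl fun t _ ↦ hc t
    have htS : G t * ∑ t' ∈ s, G t' = 0 := by
      rw [Finset.mul_sum]; exact Finset.sum_eq_zero fun t' ht' ↦ hGo t t' (by rintro rfl; exact hts ht')
    have hStc : (G t + ∑ t ∈ s, G t) * Q = Q * (G t + ∑ t ∈ s, G t) := by rw [Matrix.add_mul, Matrix.mul_add, hc t, hSc]
    have hSt : IsIdempotentElem (G t + ∑ t' ∈ s, G t') := by
      have := isIdempotentElem_sum_of_orth (insert t s) G hGi hGo
      rwa [Finset.sum_insert hts] at this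
    have hQ' : IsIdempotentElem ((G t + ∑ t ∈ s, G t) * Q) := IsIdempotentElem.mul_of_commute hStc hSt hQ
    -- split off `e = G t` from `Q' = (G t + S) Q`
    have hcomm : G t * ((G t + ∑ t ∈ s, G t) * Q) = (G t + ∑ t ∈ s, G t) * Q * G t := by
      rw [← Matrix.mul_assoc, Matrix.mul_add, (hGi t).eq, htS, add_zero, Matrix.mul_assoc, ← hc t, ← Matrix.mul_assoc, Matrix.add_mul,
        (hGi t).eq]
      congr 1
      rw [Finset.sum_mul, Finset.sum_eq_zero, add_zero]
      intro t' ht'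
      exact hGo t' t (by rintro rfl; exact hts ht')
    rw [kc_eq_add_of_comm hQ' (hGi t) hcomm]
    congr 1
    · rw [← Matrix.mul_assoc, Matrix.mul_add, (hGi t).eq, htS, add_zero]
    · rw [← Matrix.mul_assoc, Matrix.sub_mul, Matrix.one_mul, Matrix.mul_add, (hGi t).eq, htS, add_zero, add_sub_cancel_left]

/-- **Partition of unity**: `[Q] = ∑_t [G_t Q]` when moreover `∑_t G_t = 1`. [folklore] -/
theorem kc_eq_sum_of_partition [DecidableEq α] {τ : Type*} [Fintype τ] (G : τ → Matrix α α R) (hGi : ∀ t, IsIdempotentElem (G t))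
    (hGo : ∀ t t', t ≠ t' → G t * G t' = 0) (hGs : ∑ t, G t = 1) {Q : Matrix α α R} (hQ : IsIdempotentElem Q)
    (hc : ∀ t, G t * Q = Q * G t) : kc Q = ∑ t, kc (G t * Q) := by
  rw [← kc_sum_mul Finset.univ G hGi hGo hQ hc, hGs, Matrix.one_mul]

end KC







/-! ### 5. The cyclic shift of `k` slots -/

section Rot

/-- The cyclic shift of `k` slots has order dividing `k`. [folklore] -/
theorem finRotate_pow_self (k : ℕ) : (finRotate k) ^ k = 1 := by
  rcases k with _ | _ | n
  · exact Subsingleton.elim _ _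
  · decide
  · have h : orderOf (finRotate (n + 2)) = n + 2 := by
      rw [← Equiv.Perm.lcm_cycleType, cycleType_finRotate]
      simp
    have h1 := pow_orderOf_eq_one (finRotate (n + 2))
    rwa [h] at h1

end Rot


section Cyc

variable {ι κ : Type*} [Fintype ι] [DecidableEq ι] [Fintype κ] [DecidableEq κ] {k : ℕ}

/-- The matrix `T` of the **cyclic permutation of the `k` tensor slots**. [cite: Atiyah1966PowerOperations, §2 (2.7)] -/
abbrev cyc (R : Type u) [CommRing R] (ι : Type*) [Fintype ι] [DecidableEq ι] (k : ℕ) : Matrix (Fin k → ι) (Fin k → ι) R :=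
  pm R ι (finRotate k)

/-- Adams operations via cyclic power operations (Atiyah 1966 §2). [folklore] -/
theorem cyc_pow_self : cyc R ι k ^ k = 1 := by
  rw [pm_pow, finRotate_pow_self, pm_one]

/-- Adams operations via cyclic power operations (Atiyah 1966 §2). [folklore] -/
theorem cyc_mul_tpow (M : Matrix ι κ R) : cyc R ι k * tpow k M = tpow k M * cyc R κ k := pm_mul_tpow _ _

end Cyc

/-! ### 6. Eigen-idempotents acting on rectangular matrices -/

section EigMatrix

variable [Algebra ℂ R] {a b : Type*} [Fintype a] [DecidableEq a] [Fintype b] [DecidableEq b] {k : ℕ}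

/-- Intertwining: if `T X = X T'` then `E_j(T) X = X E_j(T')` (rectangular `X`). [folklore] -/
theorem eig_mul_eq_mul_eig {T : Matrix a a R} {T' : Matrix b b R} {X : Matrix a b R} (h : T * X = X * T') (j : ℤ) :
    eig k T j * X = X * eig k T' j := by
  have hpow : ∀ i : ℕ, T ^ i * X = X * T' ^ i := by
    intro i
    induction i with
    | zero => simp
    | succ i ih => rw [pow_succ, Matrix.mul_assoc, h, ← Matrix.mul_assoc, ih, Matrix.mul_assoc, ← pow_succ]
  unfold eig
  rw [Matrix.sum_mul, Matrix.mul_sum]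
  refine Finset.sum_congr rfl fun i _ ↦ ?_
  rw [Matrix.smul_mul, Matrix.mul_smul, hpow]

/-- `ℂ`-algebra homomorphisms map eigen-idempotents to eigen-idempotents. [folklore] -/
theorem eig_map {S : Type*} [CommRing S] [Algebra ℂ S] (f : R →ₐ[ℂ] S) (T : Matrix a a R) (j : ℤ) :
    (eig k T j).map f = eig k (T.map f) j := by
  change f.mapMatrix (eig k T j) = eig k (f.mapMatrix T) j
  unfold eig
  rw [map_sum]
  refine Finset.sum_congr rfl fun i _ ↦ ?_
  rw [map_smul, map_pow]

/-- Re-indexing commutes with eigen-idempotents. [folklore] -/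
theorem eig_submatrix (T : Matrix a a R) (e : b ≃ a) (j : ℤ) : (eig k T j).submatrix e e = eig k (T.submatrix e e) j := by
  change Matrix.reindexAlgEquiv ℂ R e.symm (eig k T j) = eig k (Matrix.reindexAlgEquiv ℂ R e.symm T) j
  unfold eig
  rw [map_sum]
  refine Finset.sum_congr rfl fun i _ ↦ ?_
  rw [map_smul, map_pow]

end EigMatrix

/-! ### 7. The cyclic parts `[E_j M^{⊗k}]` and `ψ^k[M]` -/

section Part

variable [Algebra ℂ R]
variable {ι κ : Type*} [Fintype ι] [DecidableEq ι] [Fintype κ] [DecidableEq κ] {k : ℕ}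

/-- The **`j`-th cyclic part** `[E_j(T) · M^{⊗k}] ∈ K₀(R)` of an idempotent matrix `M`: the class
of the `ζ^j`-eigenbundle of the cyclic permutation `T` of `M^{⊗k}` (Atiyah's `[V_j]`).
[cite: Atiyah1966PowerOperations, §2 (2.7)] -/
def part (k : ℕ) (j : ℤ) (M : Matrix ι ι R) : KZero R := kc (eig k (cyc R ι k) j * tpow k M)

/-- **`ψ^k[M] = [V_0] - [V_1]`** (Atiyah's formula (2.7) for the Adams operation on the class of a
bundle, `k` prime). [cite: Atiyah1966PowerOperations, §2 Prop. 2.5, (2.7)] -/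
def psiM (k : ℕ) (M : Matrix ι ι R) : KZero R := part k 0 M - part k 1 M

/-- Adams operations via cyclic power operations (Atiyah 1966 §2). [folklore] -/
theorem eig_cyc_mul_tpow (j : ℤ) (M : Matrix ι κ R) : eig k (cyc R ι k) j * tpow k M = tpow k M * eig k (cyc R κ k) j :=
  eig_mul_eq_mul_eig (cyc_mul_tpow M) j

/-- Adams operations via cyclic power operations (Atiyah 1966 §2). [folklore] -/
theorem isIdempotentElem_eig_cyc (hk : k ≠ 0) (j : ℤ) : IsIdempotentElem (eig k (cyc R ι k) j) :=
  isIdempotentElem_eig hk cyc_pow_self j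

/-- Adams operations via cyclic power operations (Atiyah 1966 §2). [folklore] -/
theorem isIdempotentElem_eig_mul_tpow (hk : k ≠ 0) (j : ℤ) {M : Matrix ι ι R} (hM : IsIdempotentElem M) :
    IsIdempotentElem (eig k (cyc R ι k) j * tpow k M) :=
  IsIdempotentElem.mul_of_commute (eig_cyc_mul_tpow j M) (isIdempotentElem_eig_cyc hk j) (isIdempotentElem_tpow hM)

/-- **The cyclic parts depend only on the class of `M`**: algebraically equivalent idempotents have
the same parts (Atiyah Prop. 2.2: `[E^{⊗k}] ∈ K_{S_k}(X)` depends only on `[E]`).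
[cite: Atiyah1966PowerOperations, §2 Prop. 2.2] -/
theorem part_eq_of_algEquivalent (hk : k ≠ 0) {M : Matrix ι ι R} {M' : Matrix κ κ R} (h : AlgEquivalent M M') (j : ℤ) :
    part k j M = part k j M' := by
  obtain ⟨x, y, hxy, hyx, hxyx, hyxy⟩ := h
  have hM : IsIdempotentElem M := by rw [← hxy]; change x * y * (x * y) = x * y; rw [← Matrix.mul_assoc, hxyx]
  have hM' : IsIdempotentElem M' := by rw [← hyx]; change y * x * (y * x) = y * x; rw [← Matrix.mul_assoc, hyxy]
  apply kc_eq_of_algEquivalent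
  set E := eig k (cyc R ι k) j with hE
  set E' := eig k (cyc R κ k) j with hE'
  have hEx : E * tpow k x = tpow k x * E' := eig_cyc_mul_tpow j x
  have hEy : E' * tpow k y = tpow k y * E := eig_cyc_mul_tpow j y
  have hEi : IsIdempotentElem E := isIdempotentElem_eig_cyc hk j
  have hE'i : IsIdempotentElem E' := isIdempotentElem_eig_cyc hk j
  have hEM : E * tpow k M = tpow k M * E := eig_cyc_mul_tpow j M
  have hEM' : E' * tpow k M' = tpow k M' * E' := eig_cyc_mul_tpow j M'
  refine AlgEquivalent.of_mul_eq (isIdempotentElem_eig_mul_tpow hk j hM) (isIdempotentElem_eig_mul_tpow hk j hM')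
    (x := E * tpow k x) (y := tpow k y * E) ?_ ?_
  · calc E * tpow k x * (tpow k y * E) = E * (tpow k (x * y)) * E := by rw [tpow_mul]; simp only [Matrix.mul_assoc]
      _ = E * tpow k M := by rw [hxy, Matrix.mul_assoc, ← hEM, ← Matrix.mul_assoc, hEi.eq]
  · calc tpow k y * E * (E * tpow k x) = tpow k y * (E * E) * tpow k x := by simp only [Matrix.mul_assoc]
      _ = tpow k y * tpow k x * E' := by rw [hEi.eq, Matrix.mul_assoc, hEx, Matrix.mul_assoc]
      _ = E' * tpow k M' := by rw [← tpow_mul, hyx, hEM']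

/-- Adams operations via cyclic power operations (Atiyah 1966 §2). [folklore] -/
theorem psiM_eq_of_algEquivalent (hk : k ≠ 0) {M : Matrix ι ι R} {M' : Matrix κ κ R} (h : AlgEquivalent M M') :
    psiM k M = psiM k M' := by
  rw [psiM, psiM, part_eq_of_algEquivalent hk h, part_eq_of_algEquivalent hk h]

/-- Adams operations via cyclic power operations (Atiyah 1966 §2). [folklore] -/
theorem part_submatrix (hk : k ≠ 0) {M : Matrix ι ι R} (hM : IsIdempotentElem M) (e : κ ≃ ι) (j : ℤ) :
    part k j (M.submatrix e e) = part k j M :=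
  (part_eq_of_algEquivalent hk (AlgEquivalent.submatrix hM e) j).symm

/-- Adams operations via cyclic power operations (Atiyah 1966 §2). [folklore] -/
theorem part_ofMatrix_mat (hk : k ≠ 0) {M : Matrix ι ι R} (hM : IsIdempotentElem M) (j : ℤ) :
    part k j (Idem.ofMatrix M hM).mat = part k j M :=
  part_eq_of_algEquivalent hk (Idem.algEquivalent_ofMatrix M hM) j

/-- Adams operations via cyclic power operations (Atiyah 1966 §2). [folklore] -/
theorem psiM_ofMatrix_mat (hk : k ≠ 0) {M : Matrix ι ι R} (hM : IsIdempotentElem M) :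
    psiM k (Idem.ofMatrix M hM).mat = psiM k M :=
  psiM_eq_of_algEquivalent hk (Idem.algEquivalent_ofMatrix M hM)

/-- The parts modulo `k`: `part k (j + k m) = part k j`. [folklore] -/
theorem part_add_mul (j m : ℤ) (M : Matrix ι ι R) : part k (j + k * m) M = part k j M := by
  rw [part, part, eig_add_natCast_mul]

/-! #### Line elements -/

/-- For a line element `L`, `E_0 L^{⊗k} = L^{⊗k}`: the cyclic group acts trivially. [cite: Atiyah1966PowerOperations, §2 (2.7)] -/
theorem IsLine.eig_zero_mul_tpow (hk : k ≠ 0) {L : Matrix ι ι R} (hL : IsLine L) : eig k (cyc R ι k) 0 * tpow k L = tpow k L := by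
  have h := eig_mul_of_mul_eq_smul (A := Matrix (Fin k → ι) (Fin k → ι) R) hk (T := cyc R ι k) (X := tpow k L) 0
    (by rw [zpow_zero, one_smul]; exact hL.pm_mul_tpow _) 0
  rwa [sub_self, if_pos (dvd_zero _)] at h

/-- For a line element `L`, `E_j L^{⊗k} = 0` for `j ≢ 0`. [cite: Atiyah1966PowerOperations, §2 (2.7)] -/
theorem IsLine.eig_mul_tpow_eq_zero (hk : k ≠ 0) {L : Matrix ι ι R} (hL : IsLine L) {j : ℤ} (hj : ¬ (k : ℤ) ∣ j) :
    eig k (cyc R ι k) j * tpow k L = 0 := by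
  have h := eig_mul_of_mul_eq_smul (A := Matrix (Fin k → ι) (Fin k → ι) R) hk (T := cyc R ι k) (X := tpow k L) 0
    (by rw [zpow_zero, one_smul]; exact hL.pm_mul_tpow _) j
  have hj' : ¬ (k : ℤ) ∣ 0 - j := by rwa [zero_sub, dvd_neg]
  rwa [if_neg hj'] at h

/-- Adams operations via cyclic power operations (Atiyah 1966 §2). [folklore] -/
theorem IsLine.part_zero (hk : k ≠ 0) {L : Matrix ι ι R} (hL : IsLine L) : part k 0 L = kc (tpow k L) := by
  rw [part, hL.eig_zero_mul_tpow hk]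

/-- Adams operations via cyclic power operations (Atiyah 1966 §2). [folklore] -/
theorem IsLine.part_eq_zero (hk : k ≠ 0) {L : Matrix ι ι R} (hL : IsLine L) {j : ℤ} (hj : ¬ (k : ℤ) ∣ j) : part k j L = 0 := by
  rw [part, hL.eig_mul_tpow_eq_zero hk hj, kc_zero]

/-- `ι × (Fin n → ι) ≃ (Fin (n + 1) → ι)` by `Fin.cons`. [folklore] -/
def consSlotEquiv (ι : Type*) (n : ℕ) : ι × (Fin n → ι) ≃ (Fin (n + 1) → ι) where
  toFun p := Fin.cons p.1 p.2
  invFun f := (f 0, Fin.tail f)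
  left_inv p := by simp
  right_inv f := Fin.cons_self_tail f

omit [Algebra ℂ R] [Fintype ι] [DecidableEq ι] in
/-- `M^{⊗(n+1)} ≅ M ⊗ M^{⊗n}`. [folklore] -/
theorem tpow_succ_submatrix (n : ℕ) (M : Matrix ι ι R) :
    (tpow (n + 1) M).submatrix (consSlotEquiv ι n) (consSlotEquiv ι n) = M ⊗ₖ tpow n M := by
  ext ⟨r, i⟩ ⟨c, j⟩
  simp only [submatrix_apply, tpow_apply, kroneckerMap_apply, consSlotEquiv, Equiv.coe_fn_mk, Fin.prod_univ_succ, Fin.cons_zero,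
    Fin.cons_succ]

omit [Algebra ℂ R] in
/-- **`[M^{⊗k}] = [M]^k`**. [cite: Atiyah1966PowerOperations, §2] -/
theorem kc_tpow {M : Matrix ι ι R} (hM : IsIdempotentElem M) (n : ℕ) : kc (tpow n M) = kc M ^ n := by
  induction n with
  | zero =>
    rw [pow_zero]
    have h1 : tpow 0 M = 1 := by ext i j; simp [Matrix.one_apply, Subsingleton.elim i j]
    rw [h1, kc_one]
    simp
  | succ n ih =>
    rw [← kc_submatrix (isIdempotentElem_tpow hM) (consSlotEquiv ι n), tpow_succ_submatrix, kc_kronecker hM (isIdempotentElem_tpow hM), ih,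
      pow_succ']

/-- **`ψ^k[L] = [L]^k` for a line element** (`ψ^k` of a line bundle is its `k`-th power).
[cite: Atiyah1966PowerOperations, §2 (2.7)] -/
theorem IsLine.psiM_eq (hk : 2 ≤ k) {L : Matrix ι ι R} (hL : IsLine L) (hLi : IsIdempotentElem L) : psiM k L = kc L ^ k := by
  have hk0 : k ≠ 0 := by omega
  rw [psiM, hL.part_zero hk0, hL.part_eq_zero hk0, sub_zero, kc_tpow hLi]
  intro h
  have := Int.le_of_dvd one_pos h
  omega

/-! #### Reflection symmetry `[V_j] = [V_{-j}]` -/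

/-- If a slot permutation `τ` inverts the cyclic shift, conjugation by `P_τ` carries `E_j` to `E_{-j}`. [folklore] -/
theorem conj_eig_cyc_of_inverts (hk : k ≠ 0) {τ : Equiv.Perm (Fin k)} (hτ : τ * finRotate k * τ⁻¹ = (finRotate k)⁻¹) (j : ℤ) :
    pm R ι τ * eig k (cyc R ι k) j * pm R ι τ⁻¹ = eig k (cyc R ι k) (-j) := by
  rw [conj_eig (pm_inv_mul τ) (pm_mul_inv τ), pm_mul_pm, pm_mul_pm, hτ]
  have hinv : (finRotate k)⁻¹ = (finRotate k) ^ (k - 1) := by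
    obtain ⟨m, rfl⟩ := Nat.exists_eq_succ_of_ne_zero hk
    rw [Nat.succ_sub_one]
    have h := finRotate_pow_self (m + 1)
    rw [pow_succ] at h
    exact (eq_inv_of_mul_eq_one_left h).symm
  rw [hinv, ← pm_pow]
  exact eig_pow_pred hk cyc_pow_self j

/-- **`[V_j] = [V_{-j}]`**: the reflection of the slots identifies the `ζ^j`- and
`ζ^{-j}`-eigenbundles (so for `k = 3`, `[V_1] = [V_2]`). [cite: Atiyah1966PowerOperations, §2 (2.7)] -/
theorem part_neg (hk : k ≠ 0) {τ : Equiv.Perm (Fin k)} (hτ : τ * finRotate k * τ⁻¹ = (finRotate k)⁻¹) {M : Matrix ι ι R}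
    (hM : IsIdempotentElem M) (j : ℤ) : part k (-j) M = part k j M := by
  rw [part, part, ← conj_eig_cyc_of_inverts hk hτ j, Matrix.mul_assoc, pm_mul_tpow, ← Matrix.mul_assoc,
    Matrix.mul_assoc (pm R ι τ) (eig k (cyc R ι k) j) (tpow k M)]
  exact kc_conj (isIdempotentElem_eig_mul_tpow hk j hM) (pm_inv_mul τ)

/-! #### Naturality -/

/-- **Naturality of the parts** under `ℂ`-algebra homomorphisms. [cite: Atiyah1966PowerOperations, §2] -/
theorem map_part {S : Type*} [CommRing S] [Algebra ℂ S] (f : R →ₐ[ℂ] S) (hk : k ≠ 0) (j : ℤ) {M : Matrix ι ι R} (hM : IsIdempotentElem M) :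
    KZero.map f.toRingHom (part k j M) = part k j (M.map f) := by
  rw [part, kc_map f.toRingHom (isIdempotentElem_eig_mul_tpow hk j hM), part]
  congr 1
  have hpm := pm_map (ι := ι) f.toRingHom (finRotate k)
  have htp := tpowF_map f.toRingHom (fun _ : Fin k ↦ M)
  rw [show (⇑f.toRingHom : R → S) = ⇑f from rfl] at hpm htp ⊢
  rw [Matrix.map_mul, eig_map, hpm]
  exact congrArg _ htp

/-- Adams operations via cyclic power operations (Atiyah 1966 §2). [folklore] -/
theorem map_psiM {S : Type*} [CommRing S] [Algebra ℂ S] (f : R →ₐ[ℂ] S) (hk : k ≠ 0) {M : Matrix ι ι R} (hM : IsIdempotentElem M) :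
    KZero.map f.toRingHom (psiM k M) = psiM k (M.map f) := by
  rw [psiM, psiM, map_sub, map_part f hk 0 hM, map_part f hk 1 hM]

end Part








/-! ### 8. Orthogonal families of idempotents: weighted sums -/

section Orth

variable [Algebra ℂ R] {α τ : Type*} [Fintype α] [Fintype τ]

/-- `(∑ c_t G_t)(∑ d_t G_t) = ∑ c_t d_t G_t` for pairwise orthogonal idempotents. [folklore] -/
theorem sum_smul_mul_sum_smul (G : τ → Matrix α α R) (hGi : ∀ t, IsIdempotentElem (G t)) (hGo : ∀ t t', t ≠ t' → G t * G t' = 0)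
    (c d : τ → ℂ) : (∑ t, c t • G t) * (∑ t, d t • G t) = ∑ t, (c t * d t) • G t := by
  rw [Matrix.sum_mul]
  refine Finset.sum_congr rfl fun t _ ↦ ?_
  rw [Matrix.mul_sum, Finset.sum_eq_single t]
  · rw [Matrix.smul_mul, Matrix.mul_smul, (hGi t).eq, smul_smul, mul_comm]
  · intro t' _ ht'
    rw [Matrix.smul_mul, Matrix.mul_smul, hGo t t' (Ne.symm ht'), smul_zero, smul_zero]
  · intro h; exact absurd (Finset.mem_univ t) h

/-- Adams operations via cyclic power operations (Atiyah 1966 §2). [folklore] -/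
theorem sum_smul_mul_apply (G : τ → Matrix α α R) (hGi : ∀ t, IsIdempotentElem (G t)) (hGo : ∀ t t', t ≠ t' → G t * G t' = 0)
    (c : τ → ℂ) (u : τ) : (∑ t, c t • G t) * G u = c u • G u := by
  rw [Matrix.sum_mul, Finset.sum_eq_single u]
  · rw [Matrix.smul_mul, (hGi u).eq]
  · intro t _ ht; rw [Matrix.smul_mul, hGo t u ht, smul_zero]
  · intro h; exact absurd (Finset.mem_univ u) h

/-- Adams operations via cyclic power operations (Atiyah 1966 §2). [folklore] -/
theorem apply_mul_sum_smul (G : τ → Matrix α α R) (hGi : ∀ t, IsIdempotentElem (G t)) (hGo : ∀ t t', t ≠ t' → G t * G t' = 0)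
    (c : τ → ℂ) (u : τ) : G u * (∑ t, c t • G t) = c u • G u := by
  rw [Matrix.mul_sum, Finset.sum_eq_single u]
  · rw [Matrix.mul_smul, (hGi u).eq]
  · intro t _ ht; rw [Matrix.mul_smul, hGo u t (Ne.symm ht), smul_zero]
  · intro h; exact absurd (Finset.mem_univ u) h

end Orth

/-! ### 9. The phase lemma: the free part of a cyclic decomposition does not see the character -/

section Phase

variable [Algebra ℂ R] {α τ : Type*} [Fintype α] [DecidableEq α] [Fintype τ] [DecidableEq τ] {k : ℕ}

omit [Algebra ℂ R] [Fintype τ] in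
/-- Orthogonal decomposition restricted to a finset. [folklore] -/
theorem kc_sum_mul' (s : Finset τ) (G : τ → Matrix α α R) (hGi : ∀ t ∈ s, IsIdempotentElem (G t))
    (hGo : ∀ t ∈ s, ∀ t' ∈ s, t ≠ t' → G t * G t' = 0) {Q : Matrix α α R} (hQ : IsIdempotentElem Q) (hc : ∀ t ∈ s, G t * Q = Q * G t) :
    kc ((∑ t ∈ s, G t) * Q) = ∑ t ∈ s, kc (G t * Q) := by
  classical
  -- replace `G` by its restriction to `s`
  set G' : τ → Matrix α α R := fun t ↦ if t ∈ s then G t else 0 with hG'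
  have h1 : ∑ t ∈ s, G t = ∑ t ∈ s, G' t := Finset.sum_congr rfl fun t ht ↦ by rw [hG']; dsimp only; rw [if_pos ht]
  have h2 : ∑ t ∈ s, kc (G t * Q) = ∑ t ∈ s, kc (G' t * Q) := Finset.sum_congr rfl fun t ht ↦ by rw [hG']; dsimp only; rw [if_pos ht]
  rw [h1, h2]
  refine kc_sum_mul s G' (fun t ↦ ?_) (fun t t' htt' ↦ ?_) hQ (fun t ↦ ?_)
  · by_cases ht : t ∈ s
    · simp only [hG', if_pos ht]; exact hGi t ht
    · simp only [hG', if_neg ht]; exact IsIdempotentElem.zero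
  · by_cases ht : t ∈ s
    · by_cases ht' : t' ∈ s
      · simp only [hG', if_pos ht, if_pos ht']; exact hGo t ht t' ht' htt'
      · simp only [hG', if_neg ht', Matrix.mul_zero]
    · simp only [hG', if_neg ht, Matrix.zero_mul]
  · by_cases ht : t ∈ s
    · simp only [hG', if_pos ht]; exact hc t ht
    · simp only [hG', if_neg ht, Matrix.zero_mul, Matrix.mul_zero]

/-- **Phase lemma.** Let `β` be an element of order `k` acting on a partition of unity `(G_t)` by
`β G_t β⁻¹ = G_{sh t}`, and suppose the non-fixed indices carry a *phase* `pe` with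
`pe (sh t) ≡ pe t + 1 (mod k)`. Then on the "free part" `N = ∑_{sh t ≠ t} G_t` all the
eigen-idempotents of `β` cut out the same class: `[N E_e(β) Q] = [N E_{e-1}(β) Q]`. (This is the
matrix form of "the character of an induced representation vanishes off the subgroup", used by
Atiyah to prove additivity of `ψ^k`.) [cite: Atiyah1966PowerOperations, §2 Prop. 2.3] -/
theorem kc_free_mul_eig_eq (hk : k ≠ 0) {β : Matrix α α R} (hβ : β ^ k = 1)
    (G : τ → Matrix α α R) (hGi : ∀ t, IsIdempotentElem (G t)) (hGo : ∀ t t', t ≠ t' → G t * G t' = 0) (hGs : ∑ t, G t = 1)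
    (sh : τ ≃ τ) (hsh : ∀ t, β * G t = G (sh t) * β)
    (pe : τ → ℕ) (hpe : ∀ t, sh t ≠ t → (pe (sh t) : ZMod k) = pe t + 1)
    {Q : Matrix α α R} (hQ : IsIdempotentElem Q) (hQβ : β * Q = Q * β) (hQG : ∀ t, G t * Q = Q * G t) (e : ℤ) :
    kc ((∑ t ∈ univ.filter (fun t ↦ sh t ≠ t), G t) * eig k β e * Q) =
      kc ((∑ t ∈ univ.filter (fun t ↦ sh t ≠ t), G t) * eig k β (e - 1) * Q) := by
  set N := ∑ t ∈ univ.filter (fun t ↦ sh t ≠ t), G t with hN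
  -- the phases
  set s : τ → ℂ := fun t ↦ zeta k ^ pe t with hs
  have hs0 : ∀ t, s t ≠ 0 := fun t ↦ pow_ne_zero _ (zeta_ne_zero k)
  have hsζ : ∀ t, sh t ≠ t → s (sh t) = zeta k * s t := by
    intro t ht
    simp only [hs]
    have h1 : pe (sh t) % k = (pe t + 1) % k := by
      rw [← ZMod.natCast_eq_natCast_iff', Nat.cast_succ]; exact hpe t ht
    rw [← pow_mod_of_pow_eq_one (zeta_isPrimitiveRoot hk).pow_eq_one (pe (sh t)), h1,
      pow_mod_of_pow_eq_one (zeta_isPrimitiveRoot hk).pow_eq_one, pow_succ, mul_comm]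
  -- the conjugating unit
  set W := ∑ t, s t • G t with hW
  set W' := ∑ t, (s t)⁻¹ • G t with hW'
  have hWW' : W * W' = 1 := by
    rw [hW, hW', sum_smul_mul_sum_smul G hGi hGo, ← hGs]
    exact Finset.sum_congr rfl fun t _ ↦ by rw [mul_inv_cancel₀ (hs0 t), one_smul]
  have hW'W : W' * W = 1 := by
    rw [hW, hW', sum_smul_mul_sum_smul G hGi hGo, ← hGs]
    exact Finset.sum_congr rfl fun t _ ↦ by rw [inv_mul_cancel₀ (hs0 t), one_smul]
  -- `β W' = W₂ β`
  set W₂ := ∑ u, (s (sh.symm u))⁻¹ • G u with hW₂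
  have hβW' : β * W' = W₂ * β := by
    rw [hW', hW₂, Matrix.mul_sum, Matrix.sum_mul]
    rw [← Equiv.sum_comp sh (fun u ↦ (s (sh.symm u))⁻¹ • G u * β)]
    refine Finset.sum_congr rfl fun t _ ↦ ?_
    rw [Matrix.mul_smul, Matrix.smul_mul, hsh t, Equiv.symm_apply_apply]
  -- `W β W' = D β` with `D = (1 - N) + ζ N`
  set D := ∑ u, (s u * (s (sh.symm u))⁻¹) • G u with hD
  have hWβW' : W * β * W' = D * β := by
    rw [Matrix.mul_assoc, hβW', ← Matrix.mul_assoc, hW, hW₂, sum_smul_mul_sum_smul G hGi hGo]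
  have hfix : ∀ u, sh u = u → s u * (s (sh.symm u))⁻¹ = 1 := by
    intro u hu
    have : sh.symm u = u := by rw [Equiv.symm_apply_eq]; exact hu.symm
    rw [this, mul_inv_cancel₀ (hs0 u)]
  have hfree : ∀ u, sh u ≠ u → s u * (s (sh.symm u))⁻¹ = zeta k := by
    intro u hu
    set t := sh.symm u with ht
    have htu : sh t = u := by rw [ht, Equiv.apply_symm_apply]
    have ht' : sh t ≠ t := by
      intro h
      apply hu
      rw [← htu, h]
      exact h
    rw [← htu, hsζ t ht', mul_assoc, mul_inv_cancel₀ (hs0 t), mul_one]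
  have hfixN : (∑ u ∈ univ.filter (fun u ↦ sh u = u), G u) = 1 - N := by
    rw [eq_sub_iff_add_eq, hN, ← hGs]
    exact Finset.sum_filter_add_sum_filter_not univ (fun u ↦ sh u = u) G
  have hDN : D = (1 - N) + zeta k • N := by
    rw [← hfixN, hD, hN, ← Finset.sum_filter_add_sum_filter_not univ (fun u ↦ sh u = u)]
    congr 1
    · refine Finset.sum_congr rfl fun u hu ↦ ?_
      rw [hfix u (Finset.mem_filter.1 hu).2, one_smul]
    · rw [Finset.smul_sum]
      refine Finset.sum_congr rfl fun u hu ↦ ?_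
      rw [hfree u (Finset.mem_filter.1 hu).2]
  -- `N` is an idempotent commuting with `β`, `Q`, `W`, `W'`
  have hNi : IsIdempotentElem N := isIdempotentElem_sum_of_orth _ G hGi hGo
  have hNβ : β * N = N * β := by
    rw [hN, Matrix.mul_sum, Matrix.sum_mul]
    refine Finset.sum_equiv sh (fun t ↦ ?_) (fun t _ ↦ hsh t)
    simp only [Finset.mem_filter, Finset.mem_univ, true_and]
    exact ⟨fun h h' ↦ h (sh.injective h'), fun h h' ↦ h (by rw [h']; exact h')⟩
  have hcomb_N : ∀ c : τ → ℂ, (∑ t, c t • G t) * N = N * ∑ t, c t • G t := by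
    intro c
    rw [hN, Matrix.mul_sum, Matrix.sum_mul]
    refine Finset.sum_congr rfl fun u _ ↦ ?_
    rw [sum_smul_mul_apply G hGi hGo, apply_mul_sum_smul G hGi hGo]
  have hcomb_Q : ∀ c : τ → ℂ, (∑ t, c t • G t) * Q = Q * ∑ t, c t • G t := by
    intro c
    rw [Matrix.mul_sum, Matrix.sum_mul]
    refine Finset.sum_congr rfl fun u _ ↦ ?_
    rw [Matrix.smul_mul, Matrix.mul_smul, hQG]
  have hNQ : N * Q = Q * N := by
    rw [hN, Matrix.mul_sum, Matrix.sum_mul]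
    exact Finset.sum_congr rfl fun u _ ↦ hQG u
  -- `N D^i = ζ^i N`, `D β = β D`
  have hND : N * D = zeta k • N := by
    rw [hDN, Matrix.mul_add, Matrix.mul_sub, Matrix.mul_one, hNi.eq, sub_self, zero_add, Matrix.mul_smul, hNi.eq]
  have hNDi : ∀ i : ℕ, N * D ^ i = (zeta k ^ i) • N := by
    intro i
    induction i with
    | zero => rw [pow_zero, pow_zero, Matrix.mul_one, one_smul]
    | succ i ih => rw [pow_succ, ← Matrix.mul_assoc, ih, Matrix.smul_mul, hND, smul_smul, ← pow_succ]
  have hDβ : D * β = β * D := by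
    rw [hDN, Matrix.add_mul, Matrix.mul_add, Matrix.sub_mul, Matrix.mul_sub, Matrix.one_mul, Matrix.mul_one, Matrix.smul_mul,
      Matrix.mul_smul, hNβ]
  -- `N E_e(D β) = N E_e(ζ β) = N E_{e-1}(β)`
  have hkey : N * eig k (D * β) e = N * eig k β (e - 1) := by
    have h1 : eig k β (e - 1) = eig k ((zeta k ^ (1 : ℤ)) • β) e := by rw [eig_smul]
    rw [h1, zpow_one]
    unfold eig
    rw [Matrix.mul_sum, Matrix.mul_sum]
    refine Finset.sum_congr rfl fun i _ ↦ ?_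
    rw [Matrix.mul_smul, Matrix.mul_smul, (Commute.mul_pow (show Commute D β from hDβ) i), ← Matrix.mul_assoc, hNDi,
      Matrix.smul_mul, smul_pow, Matrix.mul_smul]
  -- assemble: `W (N E_e Q) W' = N E_{e-1} Q`
  have hE : IsIdempotentElem (eig k β e) := isIdempotentElem_eig hk hβ e
  have hEQ : eig k β e * Q = Q * eig k β e := eig_comm hQβ e
  have hNE : N * eig k β e = eig k β e * N := (eig_comm hNβ e).symm
  have hM : IsIdempotentElem (N * eig k β e * Q) :=
    IsIdempotentElem.mul_of_commute (show Commute (N * eig k β e) Q by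
      change N * eig k β e * Q = Q * (N * eig k β e)
      rw [Matrix.mul_assoc, hEQ, ← Matrix.mul_assoc, hNQ, Matrix.mul_assoc])
      (IsIdempotentElem.mul_of_commute hNE hNi hE) hQ
  have hWN : W * N = N * W := hcomb_N s
  have hW'Q : Q * W' = W' * Q := (hcomb_Q _).symm
  have hconj : W * (N * eig k β e * Q) * W' = N * eig k β (e - 1) * Q := by
    calc W * (N * eig k β e * Q) * W' = N * (W * eig k β e * W') * Q := by
          simp only [← Matrix.mul_assoc]
          rw [hWN]
          simp only [Matrix.mul_assoc]
          rw [hW'Q]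
      _ = N * eig k β (e - 1) * Q := by rw [conj_eig hW'W hWW', hWβW', hkey]
  rw [← hconj, kc_conj hM hW'W]

end Phase








section PhaseCor

variable [Algebra ℂ R] {α τ : Type*} [Fintype α] [DecidableEq α] [Fintype τ] [DecidableEq τ] {k : ℕ}

/-- **Corollary of the phase lemma**: `[E_0(β) Q] - [E_1(β) Q]` only sees the `β`-fixed indices:
`[E_0 Q] - [E_1 Q] = ∑_{sh t = t} ([G_t E_0 Q] - [G_t E_1 Q])`. [cite: Atiyah1966PowerOperations, §2 Prop. 2.3] -/
theorem kc_eig_zero_sub_one_eq_sum_fixed (hk : k ≠ 0) {β : Matrix α α R} (hβ : β ^ k = 1)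
    (G : τ → Matrix α α R) (hGi : ∀ t, IsIdempotentElem (G t)) (hGo : ∀ t t', t ≠ t' → G t * G t' = 0) (hGs : ∑ t, G t = 1)
    (sh : τ ≃ τ) (hsh : ∀ t, β * G t = G (sh t) * β)
    (pe : τ → ℕ) (hpe : ∀ t, sh t ≠ t → (pe (sh t) : ZMod k) = pe t + 1)
    {Q : Matrix α α R} (hQ : IsIdempotentElem Q) (hQβ : β * Q = Q * β) (hQG : ∀ t, G t * Q = Q * G t) :
    kc (eig k β 0 * Q) - kc (eig k β 1 * Q) =
      ∑ t ∈ univ.filter (fun t ↦ sh t = t), (kc (G t * eig k β 0 * Q) - kc (G t * eig k β 1 * Q)) := by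
  set N := ∑ t ∈ univ.filter (fun t ↦ sh t ≠ t), G t with hN
  have hNi : IsIdempotentElem N := isIdempotentElem_sum_of_orth _ G hGi hGo
  have hNβ : β * N = N * β := by
    rw [hN, Matrix.mul_sum, Matrix.sum_mul]
    refine Finset.sum_equiv sh (fun t ↦ ?_) (fun t _ ↦ hsh t)
    simp only [Finset.mem_filter, Finset.mem_univ, true_and]
    exact ⟨fun h h' ↦ h (sh.injective h'), fun h h' ↦ h (by rw [h']; exact h')⟩
  have hNQ : N * Q = Q * N := by
    rw [hN, Matrix.mul_sum, Matrix.sum_mul]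
    exact Finset.sum_congr rfl fun u _ ↦ hQG u
  have hfixN : (∑ u ∈ univ.filter (fun u ↦ sh u = u), G u) = 1 - N := by
    rw [eq_sub_iff_add_eq, hN, ← hGs]
    exact Finset.sum_filter_add_sum_filter_not univ (fun u ↦ sh u = u) G
  -- decompose `[E_e Q]` along `N` and the fixed `G_t`
  have hdec : ∀ e : ℤ, kc (eig k β e * Q) = kc (N * eig k β e * Q) + ∑ t ∈ univ.filter (fun t ↦ sh t = t), kc (G t * eig k β e * Q) := by
    intro e
    have hE : IsIdempotentElem (eig k β e) := isIdempotentElem_eig hk hβ e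
    have hEQ : IsIdempotentElem (eig k β e * Q) := IsIdempotentElem.mul_of_commute (eig_comm hQβ e) hE hQ
    have hNc : N * (eig k β e * Q) = eig k β e * Q * N := by
      rw [← Matrix.mul_assoc, (eig_comm hNβ e).symm, Matrix.mul_assoc, hNQ, Matrix.mul_assoc]
    rw [kc_eq_add_of_comm hEQ hNi hNc, ← Matrix.mul_assoc, ← hfixN]
    congr 1
    rw [kc_sum_mul' _ G (fun t _ ↦ hGi t) (fun t _ t' _ h ↦ hGo t t' h) hEQ]
    · exact Finset.sum_congr rfl fun t _ ↦ by rw [Matrix.mul_assoc]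
    · intro t ht
      have hfix : sh t = t := (Finset.mem_filter.1 ht).2
      have hβt : β * G t = G t * β := by rw [hsh t, hfix]
      rw [← Matrix.mul_assoc, (eig_comm hβt e).symm, Matrix.mul_assoc, hQG t, Matrix.mul_assoc]
  rw [hdec 0, hdec 1, Finset.sum_sub_distrib]
  have hph := kc_free_mul_eig_eq hk hβ G hGi hGo hGs sh hsh pe hpe hQ hQβ hQG 1
  rw [sub_self, ← hN] at hph
  rw [hph]
  abel

end PhaseCor

/-! ### 10. Additivity of `ψ^k` -/

section Additivity

variable {ι κ : Type*} [Fintype ι] [DecidableEq ι] [Fintype κ] [DecidableEq κ] {k : ℕ}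

/-- The **type sequence** of a slot index of `(P ⊕ Q)^{⊗k}`: which slots come from `P`. [folklore] -/
def tyS (i : Fin k → ι ⊕ κ) : Fin k → Bool := fun m ↦ (i m).isLeft

omit [Fintype ι] [DecidableEq ι] [Fintype κ] [DecidableEq κ] in
/-- Adams operations via cyclic power operations (Atiyah 1966 §2). [folklore] -/
theorem tyS_comp (i : Fin k → ι ⊕ κ) (σ : Equiv.Perm (Fin k)) : tyS (i ∘ σ) = tyS i ∘ σ := rfl

/-- The **type projection** onto the slot indices of a given type sequence (a diagonal `0/1`
matrix). [cite: Atiyah1966PowerOperations, §2 Prop. 2.3] -/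
def tyP (R : Type u) [CommRing R] (ι κ : Type*) [Fintype ι] [DecidableEq ι] [Fintype κ] [DecidableEq κ] (t : Fin k → Bool) :
    Matrix (Fin k → ι ⊕ κ) (Fin k → ι ⊕ κ) R :=
  Matrix.diagonal fun i ↦ if tyS i = t then 1 else 0

/-- Adams operations via cyclic power operations (Atiyah 1966 §2). [folklore] -/
theorem tyP_apply (t : Fin k → Bool) (i j : Fin k → ι ⊕ κ) :
    tyP R ι κ t i j = if i = j then (if tyS i = t then 1 else 0) else 0 := by
  rw [tyP, diagonal_apply]

/-- Adams operations via cyclic power operations (Atiyah 1966 §2). [folklore] -/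
theorem isIdempotentElem_tyP (t : Fin k → Bool) : IsIdempotentElem (tyP R ι κ t) := by
  change tyP R ι κ t * tyP R ι κ t = tyP R ι κ t
  rw [tyP, diagonal_mul_diagonal]
  congr 1
  funext i
  split_ifs <;> simp

/-- Adams operations via cyclic power operations (Atiyah 1966 §2). [folklore] -/
theorem tyP_mul_tyP_of_ne {t t' : Fin k → Bool} (h : t ≠ t') : tyP R ι κ t * tyP R ι κ t' = 0 := by
  rw [tyP, tyP, diagonal_mul_diagonal, ← diagonal_zero]
  congr 1
  funext i
  by_cases h1 : tyS i = t
  · rw [if_pos h1, if_neg (fun h2 ↦ h (h1.symm.trans h2)), mul_zero]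
  · rw [if_neg h1, zero_mul]

/-- Adams operations via cyclic power operations (Atiyah 1966 §2). [folklore] -/
theorem sum_tyP : ∑ t, tyP R ι κ t = (1 : Matrix (Fin k → ι ⊕ κ) (Fin k → ι ⊕ κ) R) := by
  ext i j
  rw [Matrix.sum_apply]
  simp only [tyP_apply]
  by_cases hij : i = j
  · subst hij
    simp only [if_true, Matrix.one_apply_eq]
    rw [Finset.sum_ite_eq]
    simp
  · simp [hij]

/-- The cyclic shift permutes the type projections: `T D_t = D_{t ∘ rot⁻¹} T`. [cite: Atiyah1966PowerOperations, §2 Prop. 2.3] -/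
theorem pm_mul_tyP (σ : Equiv.Perm (Fin k)) (t : Fin k → Bool) :
    pm R (ι ⊕ κ) σ * tyP R ι κ t = tyP R ι κ (t ∘ ⇑σ⁻¹) * pm R (ι ⊕ κ) σ := by
  have h : pm R (ι ⊕ κ) σ * tyP R ι κ t * pm R (ι ⊕ κ) σ⁻¹ = tyP R ι κ (t ∘ ⇑σ⁻¹) := by
    rw [pm_mul, mul_pm, inv_inv, submatrix_submatrix, Function.comp_id, Function.id_comp, tyP,
      show (fun i ↦ if tyS i = t then (1 : R) else 0) = (fun i ↦ if tyS i = t then (1 : R) else 0) from rfl]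
    rw [show ((slotEquiv (ι ⊕ κ) σ : (Fin k → ι ⊕ κ) → (Fin k → ι ⊕ κ))) = ⇑(slotEquiv (ι ⊕ κ) σ) from rfl,
      submatrix_diagonal_equiv, tyP]
    congr 1
    funext i
    simp only [Function.comp_apply, slotEquiv_apply, tyS_comp]
    congr 1
    apply propext
    constructor
    · intro h; rw [← h, Function.comp_assoc, ← Equiv.Perm.coe_mul, mul_inv_cancel, Equiv.Perm.coe_one, Function.comp_id]
    · intro h; rw [h, Function.comp_assoc, ← Equiv.Perm.coe_mul, inv_mul_cancel, Equiv.Perm.coe_one, Function.comp_id]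
  rw [← h, Matrix.mul_assoc, pm_inv_mul, Matrix.mul_one]

/-- Type projections commute with tensor powers of block-diagonal matrices. [folklore] -/
theorem tyP_mul_tpow_fromBlocks (t : Fin k → Bool) (P : Matrix ι ι R) (Q : Matrix κ κ R) :
    tyP R ι κ t * tpow k (Matrix.fromBlocks P 0 0 Q) = tpow k (Matrix.fromBlocks P 0 0 Q) * tyP R ι κ t := by
  ext i j
  rw [tyP, Matrix.diagonal_mul, Matrix.mul_diagonal]
  by_cases hij : tyS i = tyS j
  · rw [hij]
    split_ifs <;> simp
  · -- some slot has different types, so the tensor power entry vanishes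
    have hz : tpow k (Matrix.fromBlocks P 0 0 Q) i j = 0 := by
      obtain ⟨m, hm⟩ : ∃ m, (i m).isLeft ≠ (j m).isLeft := by
        by_contra h
        push Not at h
        exact hij (funext h)
      rw [tpow_apply]
      apply Finset.prod_eq_zero (Finset.mem_univ m)
      rcases hi : i m with a | a <;> rcases hj : j m with b | b <;> simp_all [Matrix.fromBlocks]
    rw [hz, mul_zero, zero_mul]

/-- The all-`P` type projection cuts `P^{⊗k}` out of `(P ⊕ Q)^{⊗k}`. [cite: Atiyah1966PowerOperations, §2 Prop. 2.3] -/
theorem tyP_true_mul_tpow (P : Matrix ι ι R) (Q : Matrix κ κ R) :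
    tyP R ι κ (fun _ ↦ true) * tpow k (Matrix.fromBlocks P 0 0 Q) = tpow k (Matrix.fromBlocks P 0 0 (0 : Matrix κ κ R)) := by
  ext i j
  rw [tyP, Matrix.diagonal_mul, tpow_apply, tpow_apply]
  by_cases h : tyS i = fun _ ↦ true
  · rw [if_pos h, one_mul]
    refine Finset.prod_congr rfl fun m _ ↦ ?_
    have hm : (i m).isLeft = true := congrFun h m
    rcases hi : i m with a | a
    · rcases hj : j m with b | b <;> simp [Matrix.fromBlocks]
    · rw [hi] at hm; simp at hm
  · rw [if_neg h, zero_mul, eq_comm]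
    obtain ⟨m, hm⟩ : ∃ m, (i m).isLeft ≠ true := by
      by_contra h'
      push Not at h'
      exact h (funext h')
    apply Finset.prod_eq_zero (Finset.mem_univ m)
    rcases hi : i m with a | a
    · rw [hi] at hm; simp at hm
    · rcases hj : j m with b | b <;> simp [Matrix.fromBlocks]

/-- The all-`Q` type projection cuts `Q^{⊗k}` out of `(P ⊕ Q)^{⊗k}`. [cite: Atiyah1966PowerOperations, §2 Prop. 2.3] -/
theorem tyP_false_mul_tpow (P : Matrix ι ι R) (Q : Matrix κ κ R) :
    tyP R ι κ (fun _ ↦ false) * tpow k (Matrix.fromBlocks P 0 0 Q) = tpow k (Matrix.fromBlocks (0 : Matrix ι ι R) 0 0 Q) := by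
  ext i j
  rw [tyP, Matrix.diagonal_mul, tpow_apply, tpow_apply]
  by_cases h : tyS i = fun _ ↦ false
  · rw [if_pos h, one_mul]
    refine Finset.prod_congr rfl fun m _ ↦ ?_
    have hm : (i m).isLeft = false := congrFun h m
    rcases hi : i m with a | a
    · rw [hi] at hm; simp at hm
    · rcases hj : j m with b | b <;> simp [Matrix.fromBlocks]
  · rw [if_neg h, zero_mul, eq_comm]
    obtain ⟨m, hm⟩ : ∃ m, (i m).isLeft ≠ false := by
      by_contra h'
      push Not at h'
      exact h (funext h')
    apply Finset.prod_eq_zero (Finset.mem_univ m)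
    rcases hi : i m with a | a
    · rcases hj : j m with b | b <;> simp [Matrix.fromBlocks]
    · rw [hi] at hm; simp at hm

/-- The shift of type sequences induced by the cyclic slot permutation. [folklore] -/
abbrev tySh (k : ℕ) : (Fin k → Bool) ≃ (Fin k → Bool) := slotEquiv Bool (finRotate k)⁻¹

variable [Algebra ℂ R]

/-- **Additivity of `ψ^k` on block sums**: `ψ^k[P ⊕ Q] = ψ^k[P] + ψ^k[Q]`, given a phase function
for the non-constant type sequences (which exists for `k` prime; supplied by `decide` for
`k = 2, 3`). [cite: Atiyah1966PowerOperations, §2 Prop. 2.3] -/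
theorem psiM_fromBlocks (hk : k ≠ 0) (pe : (Fin k → Bool) → ℕ)
    (hpe : ∀ t, tySh k t ≠ t → (pe (tySh k t) : ZMod k) = pe t + 1)
    (hfix : univ.filter (fun t ↦ tySh k t = t) = {fun _ ↦ true, fun _ ↦ false})
    {P : Matrix ι ι R} {Q : Matrix κ κ R} (hP : IsIdempotentElem P) (hQ : IsIdempotentElem Q) :
    psiM k (Matrix.fromBlocks P 0 0 Q) = psiM k P + psiM k Q := by
  have hPQ : IsIdempotentElem (Matrix.fromBlocks P 0 0 Q) := isIdempotentElem_fromBlocks hP hQ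
  have h := kc_eig_zero_sub_one_eq_sum_fixed (τ := Fin k → Bool) hk (cyc_pow_self (R := R) (ι := ι ⊕ κ) (k := k))
    (tyP R ι κ) isIdempotentElem_tyP (fun t t' h ↦ tyP_mul_tyP_of_ne h) sum_tyP (tySh k)
    (fun t ↦ pm_mul_tyP (finRotate k) t) pe hpe (isIdempotentElem_tpow hPQ) (cyc_mul_tpow _)
    (fun t ↦ tyP_mul_tpow_fromBlocks t P Q)
  rw [psiM, part, part, h, hfix, Finset.sum_pair]
  · rw [psiM, psiM]
    have e1 : ∀ e : ℤ, kc (tyP R ι κ (fun _ ↦ true) * eig k (cyc R (ι ⊕ κ) k) e * tpow k (Matrix.fromBlocks P 0 0 Q)) = part k e P := by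
      intro e
      rw [Matrix.mul_assoc, eig_cyc_mul_tpow, ← Matrix.mul_assoc, tyP_true_mul_tpow, ← eig_cyc_mul_tpow]
      exact part_eq_of_algEquivalent hk (AlgEquivalent.fromBlocks_zero hP) e
    have e2 : ∀ e : ℤ, kc (tyP R ι κ (fun _ ↦ false) * eig k (cyc R (ι ⊕ κ) k) e * tpow k (Matrix.fromBlocks P 0 0 Q)) = part k e Q := by
      intro e
      rw [Matrix.mul_assoc, eig_cyc_mul_tpow, ← Matrix.mul_assoc, tyP_false_mul_tpow, ← eig_cyc_mul_tpow]
      exact part_eq_of_algEquivalent hk ((AlgEquivalent.fromBlocks_comm IsIdempotentElem.zero hQ).trans (AlgEquivalent.fromBlocks_zero hQ)) e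
    rw [e1, e1, e2, e2]
  · intro h'
    have := congrFun h' ⟨0, Nat.pos_of_ne_zero hk⟩
    simp at this

/-- **Additivity of `ψ^k` on `Idem(R)`**. [cite: Atiyah1966PowerOperations, §2 Prop. 2.3] -/
theorem psiM_add_mat (hk : k ≠ 0) (pe : (Fin k → Bool) → ℕ)
    (hpe : ∀ t, tySh k t ≠ t → (pe (tySh k t) : ZMod k) = pe t + 1)
    (hfix : univ.filter (fun t ↦ tySh k t = t) = {fun _ ↦ true, fun _ ↦ false}) (p q : Idem R) :
    psiM k (p + q).mat = psiM k p.mat + psiM k q.mat := by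
  rw [psiM_eq_of_algEquivalent hk (Idem.add_equiv_fromBlocks p q)]
  exact psiM_fromBlocks hk pe hpe hfix p.isIdempotentElem q.isIdempotentElem

omit [Fintype ι] [DecidableEq ι] in
/-- Adams operations via cyclic power operations (Atiyah 1966 §2). [folklore] -/
theorem part_zero_matrix (hk : k ≠ 0) [Fintype ι] [DecidableEq ι] (e : ℤ) : part k e (0 : Matrix ι ι R) = 0 := by
  rw [part, show tpow k (0 : Matrix ι ι R) = 0 from tpowF_zero ⟨0, Nat.pos_of_ne_zero hk⟩ rfl, Matrix.mul_zero, kc_zero]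

omit [Fintype ι] [DecidableEq ι] in
/-- Adams operations via cyclic power operations (Atiyah 1966 §2). [folklore] -/
theorem psiM_zero_matrix (hk : k ≠ 0) [Fintype ι] [DecidableEq ι] : psiM k (0 : Matrix ι ι R) = 0 := by
  rw [psiM, part_zero_matrix hk, part_zero_matrix hk, sub_zero]

end Additivity

/-! ### 11. The Adams operations `ψ²`, `ψ³` on `K₀(R)` -/

section Psi

/-- The exponents for which the cyclic construction of `ψ^k` is carried out here: `k = 2, 3`. [folklore] -/
class IsAdamsPrime (k : ℕ) : Prop where
  out : k = 2 ∨ k = 3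

/-- Adams operations via cyclic power operations (Atiyah 1966 §2). -/
instance : IsAdamsPrime 2 := ⟨Or.inl rfl⟩
/-- Adams operations via cyclic power operations (Atiyah 1966 §2). -/
instance : IsAdamsPrime 3 := ⟨Or.inr rfl⟩

variable {k : ℕ}

/-- Adams operations via cyclic power operations (Atiyah 1966 §2). [folklore] -/
theorem IsAdamsPrime.ne_zero (k : ℕ) [h : IsAdamsPrime k] : k ≠ 0 := by
  rcases h.out with rfl | rfl <;> decide

/-- Adams operations via cyclic power operations (Atiyah 1966 §2). [folklore] -/
theorem IsAdamsPrime.two_le (k : ℕ) [h : IsAdamsPrime k] : 2 ≤ k := by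
  rcases h.out with rfl | rfl <;> decide

/-- The phase data for additivity, verified by enumeration. [folklore] -/
theorem IsAdamsPrime.exists_phase (k : ℕ) [h : IsAdamsPrime k] :
    ∃ pe : (Fin k → Bool) → ℕ, (∀ t, tySh k t ≠ t → (pe (tySh k t) : ZMod k) = pe t + 1) ∧
      univ.filter (fun t ↦ tySh k t = t) = {fun _ ↦ true, fun _ ↦ false} := by
  rcases h.out with rfl | rfl
  · exact ⟨fun t ↦ if t 0 then 0 else 1, by decide, by decide⟩
  · exact ⟨fun t ↦ if t 0 = t 1 then 2 else if t 0 = t 2 then 1 else 0, by decide, by decide⟩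

/-- A slot permutation inverting the cyclic shift (the reflection). [folklore] -/
theorem IsAdamsPrime.exists_inverter (k : ℕ) [h : IsAdamsPrime k] :
    ∃ τ : Equiv.Perm (Fin k), τ * finRotate k * τ⁻¹ = (finRotate k)⁻¹ := by
  rcases h.out with rfl | rfl
  · exact ⟨1, by decide⟩
  · exact ⟨Equiv.swap 1 2, by decide⟩

variable [Algebra ℂ R] {ι : Type*} [Fintype ι] [DecidableEq ι]

/-- Adams operations via cyclic power operations (Atiyah 1966 §2). [folklore] -/
theorem psiM_add_mat' (k : ℕ) [IsAdamsPrime k] (p q : Idem R) : psiM k (p + q).mat = psiM k p.mat + psiM k q.mat := by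
  obtain ⟨pe, hpe, hfix⟩ := IsAdamsPrime.exists_phase k
  exact psiM_add_mat (IsAdamsPrime.ne_zero k) pe hpe hfix p q

/-- `ψ^k` on classes of idempotents, as an additive map `Idem(R)/≈ → K₀(R)`. [cite: Atiyah1966PowerOperations, §2 Prop. 2.3] -/
def psiClassHom (R : Type u) [CommRing R] [Algebra ℂ R] (k : ℕ) [IsAdamsPrime k] : IdemClass R →+ KZero R where
  toFun := Quotient.lift (fun p : Idem R ↦ psiM k p.mat) fun p q h ↦ psiM_eq_of_algEquivalent (IsAdamsPrime.ne_zero k) h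
  map_zero' := by
    change psiM k (0 : Matrix (Fin 0) (Fin 0) R) = 0
    exact psiM_zero_matrix (IsAdamsPrime.ne_zero k)
  map_add' := by
    rintro ⟨p⟩ ⟨q⟩
    exact psiM_add_mat' k p q

/-- Adams operations via cyclic power operations (Atiyah 1966 §2). [folklore] -/
theorem psiClassHom_mk (k : ℕ) [IsAdamsPrime k] (p : Idem R) : psiClassHom R k (IdemClass.mk p) = psiM k p.mat := rfl

/-- **The Adams operation `ψ^k : K₀(R) → K₀(R)`** (`k = 2, 3`) of a commutative `ℂ`-algebra,
constructed from the cyclic group acting on tensor powers: on the class of an idempotent `p`,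
`ψ^k[p] = [V_0] - [V_1]` with `V_j` the `ζ^j`-eigen-idempotent of the cyclic permutation of
`p^{⊗k}`. [cite: Atiyah1966PowerOperations, §2 Prop. 2.3, (2.7)] -/
def psi (R : Type u) [CommRing R] [Algebra ℂ R] (k : ℕ) [IsAdamsPrime k] : KZero R →+ KZero R :=
  Algebra.GrothendieckAddGroup.lift (psiClassHom R k)

/-- `ψ^k [p] = [V_0] - [V_1]`. [cite: Atiyah1966PowerOperations, §2 (2.7)] -/
theorem psi_of (k : ℕ) [IsAdamsPrime k] (p : Idem R) : psi R k (KZero.of p) = psiM k p.mat := by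
  rw [psi, KZero.lift_of]; rfl

/-- `ψ^k [M] = ψ^k(M)` for an idempotent matrix on any index type. [cite: Atiyah1966PowerOperations, §2 (2.7)] -/
theorem psi_kc (k : ℕ) [IsAdamsPrime k] {M : Matrix ι ι R} (hM : IsIdempotentElem M) : psi R k (kc M) = psiM k M := by
  rw [kc_eq hM, psi_of, psiM_ofMatrix_mat (IsAdamsPrime.ne_zero k)]

end Psi

end Literature.RingTheory.KTheory

end
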